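import Literature.NumberTheory.GaloisRepresentations.AbsDecompositionFiniteLevelDictionary
import Literature.NumberTheory.GaloisRepresentations.FrobeniusDensityTheorem
import Mathlib.FieldTheory.Normal.Closure
import Mathlib.NumberTheory.RamificationInertia.Galois
import HarnessLib

/-!
# The index of a relative decomposition group: `[D_A : D_A ∩ Γ_K] = e(𝔭|v) · f(𝔭|v)`, and
# complete splitting read on decomposition groups (one-closure model)

Topic `Literature/NumberTheory/GaloisRepresentations` (continues `AbsDecompositionFiniteLevelDictionary`).
PROOF-ONLY (theorems, no definition, no named fact).  abc-iut cell, GAP row G-L4d2g4-1, sub-DAG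
`plan/L4/SUBDAG-NeukirchUchida.md` row **R3 FINITE-LEVEL DICTIONARY**, item (R3.4) and the index identity
behind it; seat abc-iut-w5-d201; classical, outside the [IUTchIII] Cor. 3.12 cone.
MODEL as in the parent file: `Γ = absoluteGaloisGroup F` acting on `Ω = F̄`, `D_A = MulAction.stabilizer Γ A`
for a nonarchimedean prime `A ≠ ⊤` (valuation subring) of `Ω`, `Γ_K = K.fixingSubgroup.comap (toAlgEquiv F)`
for `K : IntermediateField F Ω`, "`A` lies over `P ⊆ 𝓞 K`" ≡ `∀ x : 𝓞 K, ((x : K) : Ω) ∈ A.nonunits ↔ x ∈ P`.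

* ENGINE through a finite Galois level `N ⊇ K` (`N : IntermediateField F Ω` finite Galois over `F`, `K → N`
  an `F`-algebra inside `Ω`), `r : Γ → Gal(N/F)` the restriction, `Q` the prime of `𝓞 N` below `A`:
  `map_stabilizer_restrictNormalHom_eq` — **`r(D_A) = Stab(Q)`** (`⊇`: lift, then move back over `Q` by the
  parent file's transitivity for `Γ_N`); `fixingSubgroup_comap_eq_comap_range_restrictScalarsHom` —
  `Γ_K = r⁻¹(Gal(N/K))`; `relIndex_range_restrictScalarsHom_stabilizer` — at finite level
  `[Stab_{Gal(N/F)}(Q) : Stab_{Gal(N/K)}(Q)] = e(𝔭|v) f(𝔭|v)` (Mathlib `Ideal.card_stabilizer_eq` + tower laws).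
* **`relIndex_stabilizer_inf_fixingSubgroup`** — for every finite `K ⊆ Ω`, `A ≠ ⊤` over `P ⊆ 𝓞 K` and over the
  prime `v` of `F`: `[D_A : D_A ∩ Γ_K] = e(P|v) · f(P|v)` (through the normal closure of `K`; Neukirch,
  *Algebraic Number Theory*, Ch. I §9 (9.3) `|G_𝔓| = e f`, (9.6)).
* (R3.4) **`stabilizer_le_of_mem_splitPrimes`** — `v ∈ splitPrimes F K`, `A` over `v` ⟹ `D_A ≤ Γ_K`;
  **`inv_mul_mem_of_mem_splitPrimes`** — for `M/F` finite Galois inside `Ω`, `Γ/Γ_M` acts freely on the primes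
  of `M` above a completely split `v`; **`mem_splitPrimes_of_forall_stabilizer_le`** — conversely `D_A ≤ Γ_K`
  for all `A ≠ ⊤` over `v`, `v` unramified in `K` ⟹ `v ∈ splitPrimes F K` (a Frobenius of the trunk fixes `K`).

## References
* [NeukirchANT1999] J. Neukirch, *Algebraic Number Theory* (1999), Ch. I §9 (9.1)–(9.6), Ch. II (8.6).
* [NeukirchSchmidtWingberg2008] Neukirch–Schmidt–Wingberg, *Cohomology of Number Fields*, XII §1–§2.
-/

noncomputable section

open Field NumberField IsDedekindDomain
open scoped Pointwise

namespace Literature.NumberTheory.GaloisRepresentations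

open Literature.AnabelianGeometry.AbsoluteAnabelian (NeukirchUchidaProof.mem_nonunits_smul_iff)

-- as in the parent file: pointwise `Γ`-actions on valuation rings / ideals are found slowly
set_option synthInstance.maxHeartbeats 160000

variable {F : Type} [Field F] [NumberField F]

section Engine

variable (N : IntermediateField F (AlgebraicClosure F)) [FiniteDimensional F N] [IsGalois F N]

omit [NumberField F] [FiniteDimensional F N] [IsGalois F N] in
/-- The restriction `r : Γ → Gal(N/F)` on elements: `(r σ) y = σ • y` for `y ∈ N`. [cite: NeukirchANT1999, Ch. IV §1] -/
theorem coe_restrictNormalHom_toAlgEquiv_apply [Normal F N] (σ : absoluteGaloisGroup F) (y : N) :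
    ((AlgEquiv.restrictNormalHom N (absoluteGaloisGroup.toAlgEquiv F σ) y : N) : AlgebraicClosure F) =
      σ • (y : AlgebraicClosure F) :=
  AlgEquiv.restrictNormalHom_apply N _ y

omit [NumberField F] [FiniteDimensional F N] [IsGalois F N] in
/-- An element of `Γ_N` restricts to the identity of `N`. [cite: NeukirchANT1999, Ch. IV §1] -/
theorem restrictNormalHom_toAlgEquiv_eq_one_of_mem [Normal F N] {δ : absoluteGaloisGroup F}
    (hδ : δ ∈ N.fixingSubgroup.comap (absoluteGaloisGroup.toAlgEquiv F).toMonoidHom) :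
    AlgEquiv.restrictNormalHom N (absoluteGaloisGroup.toAlgEquiv F δ) = 1 := by
  ext y
  rw [AlgEquiv.one_apply]
  rw [coe_restrictNormalHom_toAlgEquiv_apply]
  exact (mem_fixingSubgroup_comap_iff N δ).mp hδ _ y.2

omit [NumberField F] [FiniteDimensional F N] in
/-- **The prime of `𝓞 N` below `σ • A` is `(r σ) • Q`** (membership form): for `y ∈ 𝓞 N`,
`y ∈ 𝔪_{σ • A} ↔ (r σ)⁻¹ • y ∈ Q`. [cite: NeukirchANT1999, Ch. I §9 (9.1)] -/
theorem coe_mem_nonunits_smul_iff {A : ValuationSubring (AlgebraicClosure F)} {Q : Ideal (𝓞 N)}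
    (hQ : ∀ y : 𝓞 N, ((y : N) : AlgebraicClosure F) ∈ A.nonunits ↔ y ∈ Q)
    (σ : absoluteGaloisGroup F) (y : 𝓞 N) :
    ((y : N) : AlgebraicClosure F) ∈ (σ • A).nonunits ↔
      (AlgEquiv.restrictNormalHom N (absoluteGaloisGroup.toAlgEquiv F σ))⁻¹ • y ∈ Q := by
  rw [NeukirchUchidaProof.mem_nonunits_smul_iff, ← hQ, ← map_inv, RingOfIntegers.coe_galois_smul, ← map_inv,
    coe_restrictNormalHom_toAlgEquiv_apply]

omit [NumberField F] [FiniteDimensional F N] in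
/-- **`r(D_A) ⊆ Stab(Q)`**: an element of the decomposition group of `A` restricts into the decomposition
group of the prime `Q` of `𝓞 N` below `A`. [cite: NeukirchANT1999, Ch. I §9 (9.1)] -/
theorem restrictNormalHom_mem_stabilizer {A : ValuationSubring (AlgebraicClosure F)} {Q : Ideal (𝓞 N)}
    (hQ : ∀ y : 𝓞 N, ((y : N) : AlgebraicClosure F) ∈ A.nonunits ↔ y ∈ Q)
    {σ : absoluteGaloisGroup F} (hσ : σ ∈ MulAction.stabilizer (absoluteGaloisGroup F) A) :
    AlgEquiv.restrictNormalHom N (absoluteGaloisGroup.toAlgEquiv F σ) ∈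
      MulAction.stabilizer (N ≃ₐ[F] N) Q := by
  rw [MulAction.mem_stabilizer_iff]
  ext y
  rw [Ideal.mem_pointwise_smul_iff_inv_smul_mem, ← coe_mem_nonunits_smul_iff N hQ,
    MulAction.mem_stabilizer_iff.mp hσ, hQ]

omit [FiniteDimensional F N] in
/-- **`Stab(Q) ⊆ r(D_A)`**: every element of the decomposition group of `Q` in `Gal(N/F)` lifts to an element of
`Γ` stabilising `A` (lift arbitrarily, then correct by an element of `Γ_N` moving the lifted image of `A` back to
`A` over `Q` — transitivity of `Γ_N`, `exists_smul_eq_of_below`). [cite: NeukirchANT1999, Ch. I §9 (9.1)] -/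
theorem exists_mem_stabilizer_restrictNormalHom_eq {A : ValuationSubring (AlgebraicClosure F)} (hA : A ≠ ⊤)
    {Q : Ideal (𝓞 N)} (hQ : ∀ y : 𝓞 N, ((y : N) : AlgebraicClosure F) ∈ A.nonunits ↔ y ∈ Q)
    {g : N ≃ₐ[F] N} (hg : g ∈ MulAction.stabilizer (N ≃ₐ[F] N) Q) :
    ∃ σ ∈ MulAction.stabilizer (absoluteGaloisGroup F) A,
      AlgEquiv.restrictNormalHom N (absoluteGaloisGroup.toAlgEquiv F σ) = g := by
  obtain ⟨γ₀, hγ₀⟩ := AlgEquiv.restrictNormalHom_surjective (F := F) (K₁ := N) (E := AlgebraicClosure F) g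
  set γ : absoluteGaloisGroup F := (absoluteGaloisGroup.toAlgEquiv F).symm γ₀ with hγ
  have hrγ : AlgEquiv.restrictNormalHom N (absoluteGaloisGroup.toAlgEquiv F γ) = g := by
    rw [hγ, MulEquiv.apply_symm_apply, hγ₀]
  have hQγ : ∀ y : 𝓞 N, ((y : N) : AlgebraicClosure F) ∈ (γ • A).nonunits ↔ y ∈ Q := by
    intro y
    rw [coe_mem_nonunits_smul_iff N hQ, hrγ, ← Ideal.mem_pointwise_smul_iff_inv_smul_mem,
      MulAction.mem_stabilizer_iff.mp hg]
  obtain ⟨δ, hδ, hδA⟩ := exists_smul_eq_of_below N hA hQγ hQ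
  refine ⟨δ * γ, ?_, ?_⟩
  · rw [MulAction.mem_stabilizer_iff, mul_smul, hδA]
  · rw [map_mul, map_mul, restrictNormalHom_toAlgEquiv_eq_one_of_mem N hδ, one_mul, hrγ]

omit [FiniteDimensional F N] in
/-- **`r(D_A) = Stab(Q)`.** [cite: NeukirchANT1999, Ch. I §9 (9.1)] -/
theorem map_stabilizer_restrictNormalHom_eq {A : ValuationSubring (AlgebraicClosure F)} (hA : A ≠ ⊤)
    {Q : Ideal (𝓞 N)} (hQ : ∀ y : 𝓞 N, ((y : N) : AlgebraicClosure F) ∈ A.nonunits ↔ y ∈ Q) :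
    (MulAction.stabilizer (absoluteGaloisGroup F) A).map
        ((AlgEquiv.restrictNormalHom N).comp (absoluteGaloisGroup.toAlgEquiv F).toMonoidHom) =
      MulAction.stabilizer (N ≃ₐ[F] N) Q := by
  ext g
  rw [Subgroup.mem_map]
  constructor
  · rintro ⟨σ, hσ, rfl⟩
    exact restrictNormalHom_mem_stabilizer N hQ hσ
  · exact fun hg => exists_mem_stabilizer_restrictNormalHom_eq N hA hQ hg

variable {K : Type*} [Field K] [Algebra F K] [Algebra K N] [IsScalarTower F K N]

omit [NumberField F] [FiniteDimensional F N] [IsGalois F N] in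
/-- The image of `Gal(N/K) → Gal(N/F)` is the subgroup of automorphisms fixing (the image of) `K`. [folklore] -/
private theorem mem_range_restrictScalarsHom_iff (g : N ≃ₐ[F] N) :
    g ∈ (AlgEquiv.restrictScalarsHom F : (N ≃ₐ[K] N) →* (N ≃ₐ[F] N)).range ↔
      ∀ x : K, g (algebraMap K N x) = algebraMap K N x := by
  constructor
  · rintro ⟨ψ, rfl⟩ x
    exact ψ.commutes x
  · intro h
    exact ⟨{ g with commutes' := h }, rfl⟩

omit [NumberField F] [FiniteDimensional F N] in
/-- **`Γ_K = r⁻¹(Gal(N/K))`** for an intermediate extension `K → N` given INSIDE `Ω` (`halg`).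
[cite: NeukirchANT1999, Ch. IV §1] -/
theorem fixingSubgroup_comap_eq_comap_range_restrictScalarsHom
    (K₀ : IntermediateField F (AlgebraicClosure F)) (e : K₀ ≃ₐ[F] K)
    (halg : ∀ x : K₀, ((algebraMap K N (e x) : N) : AlgebraicClosure F) = x) :
    K₀.fixingSubgroup.comap (absoluteGaloisGroup.toAlgEquiv F).toMonoidHom =
      ((AlgEquiv.restrictScalarsHom F : (N ≃ₐ[K] N) →* (N ≃ₐ[F] N)).range).comap
        ((AlgEquiv.restrictNormalHom N).comp (absoluteGaloisGroup.toAlgEquiv F).toMonoidHom) := by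
  ext σ
  rw [mem_fixingSubgroup_comap_iff, Subgroup.mem_comap, mem_range_restrictScalarsHom_iff]
  constructor
  · intro h x
    apply Subtype.ext
    obtain ⟨x₀, rfl⟩ := e.surjective x
    rw [MonoidHom.comp_apply, MulEquiv.coe_toMonoidHom, coe_restrictNormalHom_toAlgEquiv_apply, halg]
    exact h _ x₀.2
  · intro h x hx
    have h1 := congrArg (fun y : N => (y : AlgebraicClosure F)) (h (e ⟨x, hx⟩))
    simp only [MonoidHom.comp_apply, MulEquiv.coe_toMonoidHom, coe_restrictNormalHom_toAlgEquiv_apply,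
      halg] at h1
    exact h1

omit [NumberField F] [FiniteDimensional F N] [IsGalois F N] in
/-- Index transfer along `r`: for subgroups `D ≤ Γ` and `H ≤ Gal(N/F)`,
`[D : D ∩ r⁻¹(H)] = [r(D) : r(D) ∩ H]`. [folklore] -/
private theorem relIndex_inf_comap_eq {G G' : Type*} [Group G] [Group G'] (f : G →* G') (D : Subgroup G)
    (H : Subgroup G') : (D ⊓ H.comap f).relIndex D = H.relIndex (D.map f) := by
  have h1 : (D ⊓ H.comap f).subgroupOf D = H.comap (f.comp D.subtype) := by
    ext x
    simp only [Subgroup.mem_subgroupOf, Subgroup.mem_inf, Subgroup.mem_comap, MonoidHom.comp_apply,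
      Subgroup.coe_subtype, SetLike.coe_mem, true_and]
  rw [Subgroup.relIndex, h1, Subgroup.index_comap, MonoidHom.range_comp, Subgroup.range_subtype]

variable [NumberField K]

/-- **Finite level: `[Stab_{Gal(N/F)}(Q) : Stab_{Gal(N/K)}(Q)] = e(𝔭|v) · f(𝔭|v)`** for `𝔭 = Q ∩ 𝓞 K`,
`v = Q ∩ 𝓞 F` (`|Stab_{Gal(N/F)}(Q)| = e(Q|v) f(Q|v)` and `|Stab_{Gal(N/K)}(Q)| = e(Q|𝔭) f(Q|𝔭)`, Mathlib
`Ideal.card_stabilizer_eq`; tower laws).  Neukirch I (9.3)/(9.6). [cite: NeukirchANT1999, Ch. I §9 Prop. (9.3)] -/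
theorem relIndex_range_restrictScalarsHom_stabilizer [IsGalois K N] (v : HeightOneSpectrum (𝓞 F))
    (Q : Ideal (𝓞 N)) [Q.IsPrime] [Q.LiesOver v.asIdeal] :
    ((AlgEquiv.restrictScalarsHom F : (N ≃ₐ[K] N) →* (N ≃ₐ[F] N)).range).relIndex
        (MulAction.stabilizer (N ≃ₐ[F] N) Q) =
      (Q.under (𝓞 K)).ramificationIdx (𝓞 F) * (Q.under (𝓞 K)).inertiaDeg (𝓞 F) := by
  classical
  haveI : NumberField N := NumberField.of_module_finite F N
  haveI : IsGaloisGroup (N ≃ₐ[F] N) (𝓞 F) (𝓞 N) := IsGaloisGroup.of_isFractionRing _ _ _ F N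
  haveI : IsGaloisGroup (N ≃ₐ[K] N) (𝓞 K) (𝓞 N) := IsGaloisGroup.of_isFractionRing _ _ _ K N
  haveI : (Q.under (𝓞 K)).LiesOver v.asIdeal := ⟨by rw [Ideal.under_under]; exact Ideal.LiesOver.over⟩
  haveI : Q.LiesOver (Q.under (𝓞 K)) := ⟨rfl⟩
  haveI : v.asIdeal.IsMaximal := v.isMaximal
  have hQne : Q ≠ ⊥ := Ideal.ne_bot_of_liesOver_of_ne_bot v.ne_bot Q
  haveI : (Q.under (𝓞 K)).IsPrime := Ideal.IsPrime.under (𝓞 K) Q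
  have hPne : Q.under (𝓞 K) ≠ ⊥ := Ideal.ne_bot_of_liesOver_of_ne_bot v.ne_bot (Q.under (𝓞 K))
  haveI : (Q.under (𝓞 K)).IsMaximal := Ideal.IsPrime.isMaximal inferInstance hPne
  haveI : Finite (𝓞 F ⧸ v.asIdeal) := Ideal.finiteQuotientOfFreeOfNeBot _ v.ne_bot
  haveI : Finite (𝓞 K ⧸ Q.under (𝓞 K)) := Ideal.finiteQuotientOfFreeOfNeBot _ hPne
  set res : (N ≃ₐ[K] N) →* (N ≃ₐ[F] N) := AlgEquiv.restrictScalarsHom F with hres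
  set S := MulAction.stabilizer (N ≃ₐ[F] N) Q with hS
  have hmap : (MulAction.stabilizer (N ≃ₐ[K] N) Q).map res = res.range ⊓ S := by
    ext g
    simp only [Subgroup.mem_map, Subgroup.mem_inf, MonoidHom.mem_range, MulAction.mem_stabilizer_iff, hS]
    constructor
    · rintro ⟨ψ, hψ, rfl⟩
      exact ⟨⟨ψ, rfl⟩, hψ⟩
    · rintro ⟨⟨ψ, rfl⟩, hψ⟩
      exact ⟨ψ, hψ, rfl⟩
  have hcardS : Nat.card S = Q.ramificationIdx (𝓞 F) * Q.inertiaDeg (𝓞 F) := by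
    rw [hS, Ideal.card_stabilizer_eq (G := N ≃ₐ[F] N) v.asIdeal Q,
      Ideal.ramificationIdxIn_eq_ramificationIdx v.asIdeal Q (N ≃ₐ[F] N),
      Ideal.inertiaDegIn_eq_inertiaDeg v.asIdeal Q (N ≃ₐ[F] N)]
  have hcardK : Nat.card (MulAction.stabilizer (N ≃ₐ[K] N) Q) =
      Q.ramificationIdx (𝓞 K) * Q.inertiaDeg (𝓞 K) := by
    rw [Ideal.card_stabilizer_eq (G := N ≃ₐ[K] N) (Q.under (𝓞 K)) Q,
      Ideal.ramificationIdxIn_eq_ramificationIdx (Q.under (𝓞 K)) Q (N ≃ₐ[K] N),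
      Ideal.inertiaDegIn_eq_inertiaDeg (Q.under (𝓞 K)) Q (N ≃ₐ[K] N)]
  have hcardInf : Nat.card (res.range ⊓ S : Subgroup (N ≃ₐ[F] N)) =
      Q.ramificationIdx (𝓞 K) * Q.inertiaDeg (𝓞 K) := by
    rw [← hmap, Subgroup.card_map_of_injective (AlgEquiv.restrictScalarsHom_injective F), hcardK]
  have hmul : res.range.relIndex S * Nat.card (res.range ⊓ S : Subgroup (N ≃ₐ[F] N)) = Nat.card S := by
    rw [Subgroup.relIndex, ← Subgroup.inf_subgroupOf_right,
      ← Nat.card_congr (Subgroup.subgroupOfEquivOfLe (inf_le_right : res.range ⊓ S ≤ S)).toEquiv,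
      mul_comm, Subgroup.card_mul_index]
  have he := Ideal.ramificationIdx_tower (R := 𝓞 F) (Q.under (𝓞 K)) Q
  have hf := Ideal.inertiaDeg_tower (R := 𝓞 F) (Q.under (𝓞 K)) Q
  rw [hcardInf, hcardS, he, hf] at hmul
  have hpos : 0 < Q.ramificationIdx (𝓞 K) * Q.inertiaDeg (𝓞 K) :=
    Nat.mul_pos (Ideal.ramificationIdx_pos Q (𝓞 K)) (Ideal.inertiaDeg_pos Q (𝓞 K))
  have h2 : res.range.relIndex S * (Q.ramificationIdx (𝓞 K) * Q.inertiaDeg (𝓞 K)) =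
      (Q.under (𝓞 K)).ramificationIdx (𝓞 F) * (Q.under (𝓞 K)).inertiaDeg (𝓞 F) *
        (Q.ramificationIdx (𝓞 K) * Q.inertiaDeg (𝓞 K)) := by
    rw [hmul]; ring
  exact Nat.eq_of_mul_eq_mul_right hpos h2

end Engine

section Assembly

variable (K : IntermediateField F (AlgebraicClosure F)) [FiniteDimensional F K]

/-- **`[D_A : D_A ∩ Γ_K] = e(P|v) · f(P|v)`** for every number field `K ⊆ F̄` (finite over `F`), every
nonarchimedean prime `A ≠ ⊤` of `F̄` over the prime `P` of `𝓞 K` and the prime `v` of `𝓞 F`: the index of the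
relative decomposition group `D_A ∩ Γ_K` in `D_A` is the local degree `e · f` of `P` over `v` (computed in the normal
closure `N` of `K`: `r(D_A) = Stab(Q)`, `Γ_K = r⁻¹(Gal(N/K))`, then `|Stab| = e f` at both levels and the tower laws).
Neukirch I (9.3) `|G_𝔓| = e f`, (9.6). [cite: NeukirchANT1999, Ch. I §9 Prop. (9.3)] -/
theorem relIndex_stabilizer_inf_fixingSubgroup {A : ValuationSubring (AlgebraicClosure F)} (hA : A ≠ ⊤)
    {P : Ideal (𝓞 K)} (hPA : ∀ x : 𝓞 K, ((x : K) : AlgebraicClosure F) ∈ A.nonunits ↔ x ∈ P)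
    {v : HeightOneSpectrum (𝓞 F)}
    (hv : ∀ r : 𝓞 F, algebraMap F (AlgebraicClosure F) r ∈ A.nonunits ↔ r ∈ v.asIdeal) :
    (MulAction.stabilizer (absoluteGaloisGroup F) A ⊓
        K.fixingSubgroup.comap (absoluteGaloisGroup.toAlgEquiv F).toMonoidHom).relIndex
      (MulAction.stabilizer (absoluteGaloisGroup F) A) =
      P.ramificationIdx (𝓞 F) * P.inertiaDeg (𝓞 F) := by
  classical
  set N : IntermediateField F (AlgebraicClosure F) :=
    IntermediateField.normalClosure F K (AlgebraicClosure F) with hN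
  haveI : IsGalois F N := isGalois_iff.mpr ⟨inferInstance, inferInstance⟩
  have hKN : K ≤ N := IntermediateField.le_normalClosure K
  haveI : NumberField K := NumberField.of_module_finite F K
  letI : Algebra K N := (IntermediateField.inclusion hKN).toRingHom.toAlgebra
  haveI : IsScalarTower F K N := IsScalarTower.of_algebraMap_eq fun x =>
    ((IntermediateField.inclusion hKN).commutes x).symm
  haveI : IsGalois K N := IsGalois.tower_top_of_isGalois F K N
  obtain ⟨Q, hQ, -⟩ := existsUnique_ideal_below N A
  have hQv : Q ∈ v.asIdeal.primesOver (𝓞 N) := mem_primesOver_of_below N hA hQ hv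
  haveI := hQv.1
  haveI := hQv.2
  have hPQ : Q.under (𝓞 K) = P := by
    ext x
    rw [Ideal.under, Ideal.mem_comap, ← hQ, ← hPA]
    exact Iff.rfl
  have hΓ := fixingSubgroup_comap_eq_comap_range_restrictScalarsHom N (K := K) K AlgEquiv.refl
    (fun x => rfl)
  rw [hΓ, relIndex_inf_comap_eq, map_stabilizer_restrictNormalHom_eq N hA hQ,
    relIndex_range_restrictScalarsHom_stabilizer N v Q, hPQ]

/-- **(R3.4, ⇒) A completely split prime has small decomposition groups**: if `v` splits completely in `K`
(`v ∈ splitPrimes F K`) and the nonarchimedean prime `A ≠ ⊤` of `F̄` lies over `v`, then `D_A ≤ Γ_K`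
(`e = f = 1` in `relIndex_stabilizer_inf_fixingSubgroup`). [cite: NeukirchANT1999, Ch. I §9 Prop. (9.3)] -/
theorem stabilizer_le_of_mem_splitPrimes {A : ValuationSubring (AlgebraicClosure F)} (hA : A ≠ ⊤)
    {v : HeightOneSpectrum (𝓞 F)}
    (hv : ∀ r : 𝓞 F, algebraMap F (AlgebraicClosure F) r ∈ A.nonunits ↔ r ∈ v.asIdeal)
    (hsplit : v ∈ splitPrimes F K) :
    MulAction.stabilizer (absoluteGaloisGroup F) A ≤
      K.fixingSubgroup.comap (absoluteGaloisGroup.toAlgEquiv F).toMonoidHom := by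
  haveI : NumberField K := NumberField.of_module_finite F K
  obtain ⟨P, hPA, -⟩ := existsUnique_ideal_below K A
  have hP := mem_primesOver_of_below K hA hPA hv
  haveI := hP.1
  have hf : P.inertiaDeg (𝓞 F) = 1 := hsplit.2 P hP
  have he : P.ramificationIdx (𝓞 F) = 1 := hsplit.1.ramificationIdx_eq_one hP.2
  have h := relIndex_stabilizer_inf_fixingSubgroup K hA hPA hv
  rw [he, hf, mul_one, Subgroup.relIndex_eq_one] at h
  exact fun σ hσ => (h hσ).2

omit [NumberField F] [FiniteDimensional F K] in
/-- A conjugate of a nontrivial valuation ring is nontrivial. [cite: NeukirchANT1999, Ch. II §9 (9.1)] -/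
private theorem smul_ne_top {A : ValuationSubring (AlgebraicClosure F)} (hA : A ≠ ⊤)
    (σ : absoluteGaloisGroup F) : σ • A ≠ ⊤ := by
  intro h
  apply hA
  rw [eq_top_iff]
  intro x _
  have hx : σ • x ∈ σ • A := by rw [h]; exact ValuationSubring.mem_top _
  rwa [ValuationSubring.mem_pointwise_smul_iff_inv_smul_mem, inv_smul_smul] at hx

/-- **(R3.4) Free action over a completely split prime, Galois case**: for `M/F` finite Galois inside `F̄`,
`v ∈ splitPrimes F M`, `A ≠ ⊤` over `v`: if `σ • A` and `σ' • A` lie over the same prime `P` of `𝓞 M`, then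
`σ⁻¹ σ' ∈ Γ_M` — i.e. `Γ/Γ_M = Gal(M/F)` acts freely on the primes of `M` above `v` (transitivity of `Γ_M`,
`D_A ≤ Γ_M`, `Γ_M ⊴ Γ`). [cite: NeukirchANT1999, Ch. I §9 Prop. (9.3)] -/
theorem inv_mul_mem_of_mem_splitPrimes [IsGalois F K] {A : ValuationSubring (AlgebraicClosure F)} (hA : A ≠ ⊤)
    {v : HeightOneSpectrum (𝓞 F)}
    (hv : ∀ r : 𝓞 F, algebraMap F (AlgebraicClosure F) r ∈ A.nonunits ↔ r ∈ v.asIdeal)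
    (hsplit : v ∈ splitPrimes F K) {P : Ideal (𝓞 K)} {σ σ' : absoluteGaloisGroup F}
    (hσ : ∀ x : 𝓞 K, ((x : K) : AlgebraicClosure F) ∈ (σ • A).nonunits ↔ x ∈ P)
    (hσ' : ∀ x : 𝓞 K, ((x : K) : AlgebraicClosure F) ∈ (σ' • A).nonunits ↔ x ∈ P) :
    σ⁻¹ * σ' ∈ K.fixingSubgroup.comap (absoluteGaloisGroup.toAlgEquiv F).toMonoidHom := by
  obtain ⟨δ, hδ, hδA⟩ := exists_smul_eq_of_below K (smul_ne_top hA σ') hσ hσ'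
  have hD : σ'⁻¹ * δ * σ ∈ MulAction.stabilizer (absoluteGaloisGroup F) A := by
    rw [MulAction.mem_stabilizer_iff, mul_smul, mul_smul, hδA, inv_smul_smul]
  have h1 := stabilizer_le_of_mem_splitPrimes K hA hv hsplit hD
  haveI : K.fixingSubgroup.Normal := (InfiniteGalois.normal_iff_isGalois K).mpr inferInstance
  haveI : (K.fixingSubgroup.comap (absoluteGaloisGroup.toAlgEquiv F).toMonoidHom).Normal :=
    Subgroup.Normal.comap inferInstance _
  have h2 : σ'⁻¹ * δ * σ'⁻¹⁻¹ ∈ K.fixingSubgroup.comap (absoluteGaloisGroup.toAlgEquiv F).toMonoidHom :=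
    Subgroup.Normal.conj_mem inferInstance δ hδ σ'⁻¹
  rw [inv_inv] at h2
  have h3 : σ⁻¹ * σ' = (σ'⁻¹ * δ * σ)⁻¹ * (σ'⁻¹ * δ * σ') := by group
  rw [h3]
  exact Subgroup.mul_mem _ (Subgroup.inv_mem _ h1) h2

/-- **(R3.4, ⇐) Small decomposition groups force complete splitting**: if `v` is unramified in `K` and
`D_A ≤ Γ_K` for every nonarchimedean prime `A ≠ ⊤` of `F̄` over `v`, then `v` splits completely in `K`: a
Frobenius `Φ ∈ D_A` of the trunk (`exists_isArithFrobAt_of_mem_primesAbove_holds`) fixes `K`, so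
`y ^ {N v} ≡ Φ • y = y` for `y ∈ 𝓞 K` and `f(P|v) = 1` (`inertiaDeg_eq_one_of_forall_pow_sub_mem'`).
[cite: NeukirchANT1999, Ch. I §9 Prop. (9.4)] -/
theorem mem_splitPrimes_of_forall_stabilizer_le {v : HeightOneSpectrum (𝓞 F)}
    (hunr : Algebra.IsUnramifiedIn (𝓞 K) v.asIdeal)
    (h : ∀ A : ValuationSubring (AlgebraicClosure F), A ≠ ⊤ →
      (∀ r : 𝓞 F, algebraMap F (AlgebraicClosure F) r ∈ A.nonunits ↔ r ∈ v.asIdeal) →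
      MulAction.stabilizer (absoluteGaloisGroup F) A ≤
        K.fixingSubgroup.comap (absoluteGaloisGroup.toAlgEquiv F).toMonoidHom) :
    v ∈ splitPrimes F K := by
  classical
  haveI : NumberField K := NumberField.of_module_finite F K
  refine ⟨hunr, fun P hP => ?_⟩
  haveI := hP.1
  haveI := hP.2
  have hPne : P ≠ ⊥ := Ideal.ne_bot_of_liesOver_of_ne_bot v.ne_bot P
  haveI : P.IsMaximal := hP.1.isMaximal hPne
  obtain ⟨A, hA, hPA⟩ := exists_valuationSubring_below K P
  have hv : ∀ r : 𝓞 F, algebraMap F (AlgebraicClosure F) r ∈ A.nonunits ↔ r ∈ v.asIdeal := fun r => by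
    rw [← mem_under_of_below K A hPA r, ← hP.2.over]
  haveI := absIntegersCentre_isPrime A
  have hcentre : absIntegersCentre A ∈ v.primesAbove := by
    refine ⟨inferInstance, ⟨?_⟩⟩
    ext r
    rw [hP.2.over, Ideal.under, Ideal.under, Ideal.mem_comap, Ideal.mem_comap,
      eq_comap_absIntegersCentre_of_below K A hPA, Ideal.mem_comap]
    exact Iff.rfl
  obtain ⟨Φ, hΦ⟩ := HeightOneSpectrum.exists_isArithFrobAt_of_mem_primesAbove_holds hcentre
  have hΦA : Φ ∈ MulAction.stabilizer (absoluteGaloisGroup F) A := by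
    rw [stabilizer_eq_stabilizer_absIntegersCentre A hA]
    exact hΦ.mem_stabilizer
  have hΦK := h A hA hv hΦA
  haveI : v.asIdeal.IsMaximal := v.isMaximal
  haveI : Finite (𝓞 F ⧸ v.asIdeal) := Ideal.finiteQuotientOfFreeOfNeBot _ v.ne_bot
  have hq1 : 1 < Nat.card (𝓞 F ⧸ v.asIdeal) := by
    rw [← Submodule.cardQuot_apply, ← Ideal.absNorm_apply]
    exact NumberField.HeightOneSpectrum.one_lt_absNorm v
  refine inertiaDeg_eq_one_of_forall_pow_sub_mem' v.asIdeal P hq1 fun y => ?_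
  set ι := EllipticCurves.ringOfIntegersToIntegralClosure (k := F) (Ω := AlgebraicClosure F) K with hι
  have h1 := hΦ (ι y)
  rw [MulSemiringAction.toAlgHom_apply, ← hcentre.2.over] at h1
  have hfix : Φ • ι y = ι y := by
    apply Subtype.ext
    rw [integralClosure.coe_smul, EllipticCurves.coe_ringOfIntegersToIntegralClosure]
    exact (mem_fixingSubgroup_comap_iff K Φ).mp hΦK _ (y : K).2
  have h2 : ι y - ι y ^ Nat.card (𝓞 F ⧸ v.asIdeal) ∈ absIntegersCentre A := by
    have h2' : Φ • ι y - ι y ^ Nat.card (𝓞 F ⧸ v.asIdeal) = ι y - ι y ^ Nat.card (𝓞 F ⧸ v.asIdeal) := by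
      rw [hfix]
    rw [← h2']
    exact h1
  have h3 : ι y ^ Nat.card (𝓞 F ⧸ v.asIdeal) - ι y ∈ absIntegersCentre A := by
    rw [← neg_sub]
    exact (absIntegersCentre A).neg_mem h2
  have h4 : ι (y ^ Nat.card (𝓞 F ⧸ v.asIdeal) - y) ∈ absIntegersCentre A := by
    rw [map_sub, map_pow]
    exact h3
  rw [eq_comap_absIntegersCentre_of_below K A hPA, Ideal.mem_comap]
  exact h4

end Assembly

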